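import Summits.AtomisticToContinuum.Crystallization.Theorems.ChartedZeroExcessLayeredLatticeLiouvilleZZZYRCY

/-!
# Charted zero-excess layered-lattice Liouville — ZZZYRCZL: the PER-BOX CO-LIPSCHITZ CONSTANT (lever L-cB made a lemma)

Cell `decomp-a2c`, lens 2, generation 100; line (D) TAIL-DEBIT of `UniformEquilStabilityAt`, FAR-FAR column.  The closed king remainder
(ZZZYRCR `schemeDominatedOnP_remainder_king_far`) is the only place of the three-way box reader where the co-Lipschitz constant of the word
enters the numbers (`… / (9·c⁸·…)`), and the readers ZZZYRCT `boxSchemeP_of_split` / ZZZYRCY `boxSchemeP_of_cover3` take it from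
admissibility — the GLOBAL `c₀` of `UniformEquilStabilityAt s Λ κ₀ c₀`.  STRUCTURAL FACT recorded here (lens «special vs generic»): in the
PERIODIC-LETTER labelling of record (registry letters `0/1/2` per layer — the labelling the θ⁰ chord data, the Ξ slabs and `IdealNear` are written
in) the binding pair for the sup-metric co-Lipschitz constant of an ideal word with a `±2` registry step (fcc `[0,1,2]`, 9R, every
Hägg-unbalanced word) is NOT the stacking column (ratio `√(2/3)`) but the `C → A` second-neighbour bond `e = (4t₁ − 2t₂)/3 + step` of ideal
length `√2` at index sup-distance `2` (ratio `1/√2`); in integers: `9·Δ² ≤ 2·n9W` for each of the three index components, with equality at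
`(Δγ, Δm, δ) = ((∓2, 0), ∓1, ±2)`.  Consequently a box with length comparison `λ_B²·n9 ≤ 9‖e‖²` (`IdealLengthCmp`) carries its OWN
co-Lipschitz constant `c_B` with `2c_B² ≤ λ_B²` — PROVED below from the box comparison alone, no admissibility clause used — and the far-far
numeric instance of a box is taken at `c_B`, decoupled from the statement's `c₀`:

§1 `letterDiff_sq_le` (`(reg m' − reg m)² ≤ 4(m' − m)²` for letters in `{0,1,2}`), the polynomial identity behind `9Δ² ≤ 2·n9`, and
   `nine_sq_le_two_n9W` (all three components);
§2 ★ `isLayeredCrystal_of_idealLengthCmp : IdealLengthCmp wd λ μ a b w → 0 ≤ c → 2c² ≤ λ² → IsLayeredCrystal c a b w`;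
§3 the readers with a PER-BOX constant: `boxSchemeP_of_splitBox`, `boxSchemeP_of_cover3Box` — verbatim ZZZYRCT/ZZZYRCY except that the
   co-Lipschitz hypothesis of the king system and of the far-far remainder is a box hypothesis `hwB` at `cB` (discharged by §2 from the box's
   `IdealLengthCmp`), and the numeric inequality `hθ` is read at `cB`.
[g100]
-/

namespace Summit.AtomisticToContinuum.Crystallization.Theorems.ChartedZeroExcessLayeredLatticeLiouville

open Summit.AtomisticToContinuum.Crystallization.Theorems.ChartedPlanarOrderRigidityDoor (E3)

/-! ### §1 index components against the ideal length -/

/-- letters in `{0,1,2}` ⇒ the registry difference between layers `m, m'` satisfies `(reg m' − reg m)² ≤ 4·(m' − m)²` (it vanishes for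
`m = m'` and is at most `4` otherwise). [g100] -/
theorem letterDiff_sq_le {wd : List ℤ} (h : ∀ c ∈ wd, 0 ≤ c ∧ c ≤ 2) (m m' : ℤ) :
    (regW wd m' - regW wd m) ^ 2 ≤ 4 * (m' - m) ^ 2 := by
  rcases eq_or_ne m' m with hmm | hmm
  · subst hmm; simp
  · obtain ⟨h0, h2⟩ := regW_bounds h m
    obtain ⟨h0', h2'⟩ := regW_bounds h m'
    have hsq : 1 ≤ (m' - m) ^ 2 := by
      rcases lt_or_gt_of_ne (sub_ne_zero.mpr hmm) with hlt | hgt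
      · nlinarith
      · nlinarith
    nlinarith

/-- the polynomial inequality: `δ² ≤ 4Δm²` ⇒ `9u² ≤ 2·((3u+δ)² + (3u+δ)(3v+δ) + (3v+δ)² + 6Δm²)` — from the identity
`4·(…) − 18u² = ((3u+δ) + 2(3v+δ))² + 9(u+δ)² + (24Δm² − 6δ²)`. [g100] -/
theorem nine_sq_le_two_qhex (u v δ n : ℤ) (hδ : δ ^ 2 ≤ 4 * n ^ 2) :
    9 * u ^ 2 ≤ 2 * ((3 * u + δ) * (3 * u + δ) + (3 * u + δ) * (3 * v + δ) + (3 * v + δ) * (3 * v + δ) + 6 * n ^ 2) := by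
  nlinarith [sq_nonneg (3 * u + δ + 2 * (3 * v + δ)), sq_nonneg (u + δ)]

/-- ★ **`9·Δ² ≤ 2·n9W`** for each index component `Δ ∈ {Δγ₀, Δγ₁, Δm}` of a pair, letters in `{0,1,2}`: the ideal length controls the
sup index distance with the constant `1/√2` (sharp: the `C → A` bond `((∓2,0), ∓1)` has `n9 = 18`). [g100] -/
theorem nine_sq_le_two_n9W {wd : List ℤ} (h : ∀ c ∈ wd, 0 ≤ c ∧ c ≤ 2) (x : (Cell 2 × ℤ) × (Cell 2 × ℤ)) :
    9 * (x.2.1 0 - x.1.1 0) ^ 2 ≤ 2 * n9W wd x ∧ 9 * (x.2.1 1 - x.1.1 1) ^ 2 ≤ 2 * n9W wd x ∧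
      9 * (x.2.2 - x.1.2) ^ 2 ≤ 2 * n9W wd x := by
  have hδ := letterDiff_sq_le h x.1.2 x.2.2
  have e0 : refW0 wd x.2 - refW0 wd x.1 = 3 * (x.2.1 0 - x.1.1 0) + (regW wd x.2.2 - regW wd x.1.2) := by unfold refW0; ring
  have e1 : refW1 wd x.2 - refW1 wd x.1 = 3 * (x.2.1 1 - x.1.1 1) + (regW wd x.2.2 - regW wd x.1.2) := by unfold refW1; ring
  have hn : n9W wd x = (refW0 wd x.2 - refW0 wd x.1) * (refW0 wd x.2 - refW0 wd x.1) +
      (refW0 wd x.2 - refW0 wd x.1) * (refW1 wd x.2 - refW1 wd x.1) + (refW1 wd x.2 - refW1 wd x.1) * (refW1 wd x.2 - refW1 wd x.1) +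
      6 * (x.2.2 - x.1.2) ^ 2 := rfl
  refine ⟨?_, ?_, ?_⟩
  · rw [hn, e0, e1]; exact nine_sq_le_two_qhex _ _ _ _ hδ
  · have := nine_sq_le_two_qhex (x.2.1 1 - x.1.1 1) (x.2.1 0 - x.1.1 0) (regW wd x.2.2 - regW wd x.1.2) (x.2.2 - x.1.2) hδ
    rw [hn, e0, e1]; nlinarith [this]
  · rw [hn, e0, e1]
    nlinarith [sq_nonneg (3 * (x.2.1 0 - x.1.1 0) + (regW wd x.2.2 - regW wd x.1.2) +
      (3 * (x.2.1 1 - x.1.1 1) + (regW wd x.2.2 - regW wd x.1.2))),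
      sq_nonneg (3 * (x.2.1 0 - x.1.1 0) + (regW wd x.2.2 - regW wd x.1.2)),
      sq_nonneg (3 * (x.2.1 1 - x.1.1 1) + (regW wd x.2.2 - regW wd x.1.2))]

/-! ### §2 the box's own co-Lipschitz constant -/

/-- one index component: `c²·Δ² ≤ ‖e‖²` from the length comparison and §1. [g100] -/
theorem sq_idx_le_normSq {wd : List ℤ} {lam mu c : ℝ} {a b : E3} {w : ℤ → E3} (hc2 : 2 * c ^ 2 ≤ lam ^ 2)
    (hL : IdealLengthCmp wd lam mu a b w) (x : (Cell 2 × ℤ) × (Cell 2 × ℤ)) {Δ : ℤ} (hΔ : 9 * Δ ^ 2 ≤ 2 * n9W wd x) :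
    c ^ 2 * (Δ : ℝ) ^ 2 ≤ ‖bondVec a b w x‖ ^ 2 := by
  have h1 := (hL x).1
  have hΔ' : 9 * (Δ : ℝ) ^ 2 ≤ 2 * (n9W wd x : ℝ) := by exact_mod_cast hΔ
  nlinarith [sq_nonneg (Δ : ℝ), sq_nonneg c]

/-- one index component as a distance bound: `|Δ| ≤ ‖e‖ / c` for `0 < c`. [g100] -/
theorem abs_idx_le_norm_div {c : ℝ} (hc : 0 < c) {Δ : ℤ} {e : E3} (h : c ^ 2 * (Δ : ℝ) ^ 2 ≤ ‖e‖ ^ 2) :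
    |(Δ : ℝ)| ≤ ‖e‖ / c := by
  rw [le_div_iff₀ hc]
  have h' : (|(Δ : ℝ)| * c) ^ 2 ≤ ‖e‖ ^ 2 := by rw [mul_pow, sq_abs]; linarith
  exact (pow_le_pow_iff_left₀ (by positivity) (norm_nonneg _) two_ne_zero).mp h'

/-- ★★ **THE BOX'S OWN CO-LIPSCHITZ CONSTANT**: a word with letters in `{0,1,2}` whose bonds satisfy the box length comparison
`λ²·n9 ≤ 9‖e‖²` (`IdealLengthCmp wd λ μ`) is `c`-co-Lipschitz (`IsLayeredCrystal c`, sup index metric) for every `0 ≤ c` with `2c² ≤ λ²` —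
no clause of `IsAdmissibleWord` is used.  The K-file takes a rational `c_B ≤ λ_B/√2`. [g100] -/
theorem isLayeredCrystal_of_idealLengthCmp {wd : List ℤ} {lam mu c : ℝ} {a b : E3} {w : ℤ → E3} (h012 : ∀ l ∈ wd, 0 ≤ l ∧ l ≤ 2)
    (hc : 0 ≤ c) (hc2 : 2 * c ^ 2 ≤ lam ^ 2) (hL : IdealLengthCmp wd lam mu a b w) : IsLayeredCrystal c a b w := by
  intro p q
  rcases hc.eq_or_lt with hc0 | hcp
  · rw [← hc0, zero_mul]; exact norm_nonneg _
  -- the pair `(q, p)`: `bondVec a b w (q, p) = lsite p − lsite q`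
  have hb : bondVec a b w (q, p) = lsite a b w p.1 p.2 - lsite a b w q.1 q.2 := rfl
  obtain ⟨h0, h1, h2⟩ := nine_sq_le_two_n9W h012 (q, p)
  have g0 := abs_idx_le_norm_div hcp (sq_idx_le_normSq hc2 hL (q, p) h0)
  have g1 := abs_idx_le_norm_div hcp (sq_idx_le_normSq hc2 hL (q, p) h1)
  have g2 := abs_idx_le_norm_div hcp (sq_idx_le_normSq hc2 hL (q, p) h2)
  rw [hb] at g0 g1 g2
  simp only [Int.cast_sub] at g0 g1 g2
  have hr : 0 ≤ ‖lsite a b w p.1 p.2 - lsite a b w q.1 q.2‖ / c := by positivity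
  rw [← le_div_iff₀' hcp, Prod.dist_eq]
  refine max_le ((dist_pi_le_iff hr).2 fun i => ?_) ?_
  · fin_cases i
    · simpa [Int.dist_eq] using g0
    · simpa [Int.dist_eq] using g1
  · simpa [Int.dist_eq] using g2

/-! ### §3 the readers with a per-box co-Lipschitz constant -/

/-- ★★ **THE PER-BOX READER AT THE BOX'S CONSTANT** (ZZZYRCT `boxSchemeP_of_split` with `hwB`): the king system and the far-far remainder run at
a box constant `cB` supplied per admissible word of the box (`hwB`, from `isLayeredCrystal_of_idealLengthCmp`); `hθ` is read at `cB`. [g100] -/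
theorem boxSchemeP_of_splitBox {s Λ c₀ ℓ₀ ϱ α D θ cB : ℝ} (hα : 0 < α) (hcB : 0 < cB) (hϱ0 : 0 < ϱ) (hD : 0 < D) {nD n₁ : ℕ}
    (hnD : (nD : ℝ) - 1 ≤ D / ϱ) (h2 : 2 ≤ n₁) (hnD₁ : nD ≤ n₁)
    (hθ : ∑ n ∈ Finset.Ico nD n₁, (2 * (n : ℝ) * (n + 1) * (2 * n + 1) / 3) * (7 * (n : ℝ) / D ^ 8) +
        14 * ((n₁ : ℝ) + 1) * (2 * n₁ + 1) / (9 * cB ^ 8 * (n₁ : ℝ) ^ 2 * ((n₁ : ℝ) - 1) ^ 3) ≤ θ)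
    {B : (E3 ≃L[ℝ] E3) → (ℤ → E3) → Prop} {np₁ : (E3 ≃L[ℝ] E3) → (ℤ → E3) → (Cell 2 × ℤ) × (Cell 2 × ℤ) → ℕ}
    {z₁ : (E3 ≃L[ℝ] E3) → (ℤ → E3) → (Cell 2 × ℤ) × (Cell 2 × ℤ) → ℕ → Cell 2 × ℤ}
    {ΘR₁ ΘN₁ : (E3 ≃L[ℝ] E3) → (ℤ → E3) → (Cell 2 × ℤ) × (Cell 2 × ℤ) → ℝ}
    (hgen : ∀ (L : E3 ≃L[ℝ] E3) (w' : ℤ → E3), B L w' → ‖gen₁ L‖ + ‖gen₂ L‖ + ℓ₀ ≤ ϱ)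
    (hwB : ∀ a : ℝ, 0 < a → ∀ (L : E3 ≃L[ℝ] E3) (w' : ℤ → E3), IsAdmissibleWord a s Λ c₀ ℓ₀ L w' → B L w' →
      IsLayeredCrystal cB (gen₁ L) (gen₂ L) w')
    (hnear : ∀ a : ℝ, 0 < a → ∀ (L : E3 ≃L[ℝ] E3) (w' : ℤ → E3), IsAdmissibleWord a s Λ c₀ ℓ₀ L w' → B L w' →
      IsPathSystemOn ϱ (gen₁ L) (gen₂ L) w' (fun x => ‖bondVec (gen₁ L) (gen₂ L) w' x‖ ≤ D) (np₁ L w') (z₁ L w') ∧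
        SchemeDominatedOnP ϱ α (gen₁ L) (gen₂ L) w' (np₁ L w') (z₁ L w') (fun x => ‖bondVec (gen₁ L) (gen₂ L) w' x‖ ≤ D)
          (ΘR₁ L w') (ΘN₁ L w')) :
    BoxSchemeP s Λ c₀ ℓ₀ ϱ α B (fun L w' => pathSpliceN D (gen₁ L) (gen₂ L) w' (np₁ L w') kingN)
      (fun L w' => pathSpliceZ D (gen₁ L) (gen₂ L) w' (z₁ L w') kingZ)
      (fun L w' y => ΘR₁ L w' y + (1 + α) * θ) (fun L w' y => ΘN₁ L w' y + (1 + α⁻¹) * θ) := by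
  intro a ha L w' hA hB
  obtain ⟨hP₁, hS₁⟩ := hnear a ha L w' hA hB
  have hw : IsLayeredCrystal cB (gen₁ L) (gen₂ L) w' := hwB a ha L w' hA hB
  have hlip : ∀ m : ℤ, ‖w' (m + 1) - w' m‖ ≤ ℓ₀ := hA.2.2.2.2.1
  have hϱ := hgen L w' hB
  have hfar := schemeDominatedOnP_remainder_king_far (θ := θ) hα hcB hw hlip hϱ hϱ0 hD hnD h2 hnD₁ hθ
  exact ⟨isPathSystem_splice hP₁ (isPathSystemOn_of (isPathSystem_king hcB hw hlip hϱ) _),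
    schemeDominatedP_of_split D (schemeDominatedOnP_splice_le hS₁) (schemeDominatedOnP_splice_gt hfar)⟩

/-- ★★★ **THE THREE-WAY BOX READER AT THE BOX'S CONSTANT** (ZZZYRCY `boxSchemeP_of_cover3` with `hwB`): NEAR reader + MIDDLE king-table
domination + `‖gen₁ L‖ + ‖gen₂ L‖ + ℓ₀ ≤ ϱ` + per-word co-Lipschitz at `cB` + the far-far numeric inequality AT `cB`. [g100] -/
theorem boxSchemeP_of_cover3Box {s Λ c₀ ℓ₀ ϱ α D θ cB : ℝ} (hα : 0 < α) (hcB : 0 < cB) (hϱ0 : 0 < ϱ) (hD : 0 < D) {nD n₁ : ℕ}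
    (hnD : (nD : ℝ) - 1 ≤ D / ϱ) (h2 : 2 ≤ n₁) (hnD₁ : nD ≤ n₁)
    (hθ : ∑ n ∈ Finset.Ico nD n₁, (2 * (n : ℝ) * (n + 1) * (2 * n + 1) / 3) * (7 * (n : ℝ) / D ^ 8) +
        14 * ((n₁ : ℝ) + 1) * (2 * n₁ + 1) / (9 * cB ^ 8 * (n₁ : ℝ) ^ 2 * ((n₁ : ℝ) - 1) ^ 3) ≤ θ)
    (wd : List ℤ) (hi : ℤ) {B : (E3 ≃L[ℝ] E3) → (ℤ → E3) → Prop}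
    {np₁ : (E3 ≃L[ℝ] E3) → (ℤ → E3) → (Cell 2 × ℤ) × (Cell 2 × ℤ) → ℕ}
    {z₁ : (E3 ≃L[ℝ] E3) → (ℤ → E3) → (Cell 2 × ℤ) × (Cell 2 × ℤ) → ℕ → Cell 2 × ℤ}
    {ΘR₁ ΘN₁ ΘR₂ ΘN₂ : (E3 ≃L[ℝ] E3) → (ℤ → E3) → (Cell 2 × ℤ) × (Cell 2 × ℤ) → ℝ}
    (hgen : ∀ (L : E3 ≃L[ℝ] E3) (w' : ℤ → E3), B L w' → ‖gen₁ L‖ + ‖gen₂ L‖ + ℓ₀ ≤ ϱ)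
    (hwB : ∀ a : ℝ, 0 < a → ∀ (L : E3 ≃L[ℝ] E3) (w' : ℤ → E3), IsAdmissibleWord a s Λ c₀ ℓ₀ L w' → B L w' →
      IsLayeredCrystal cB (gen₁ L) (gen₂ L) w')
    (hnear : ∀ a : ℝ, 0 < a → ∀ (L : E3 ≃L[ℝ] E3) (w' : ℤ → E3), IsAdmissibleWord a s Λ c₀ ℓ₀ L w' → B L w' →
      IsPathSystemOn ϱ (gen₁ L) (gen₂ L) w' (IdealNear wd hi) (np₁ L w') (z₁ L w') ∧
        SchemeDominatedOnP ϱ α (gen₁ L) (gen₂ L) w' (np₁ L w') (z₁ L w') (IdealNear wd hi) (ΘR₁ L w') (ΘN₁ L w'))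
    (hmid : ∀ a : ℝ, 0 < a → ∀ (L : E3 ≃L[ℝ] E3) (w' : ℤ → E3), IsAdmissibleWord a s Λ c₀ ℓ₀ L w' → B L w' →
      SchemeDominatedOnP ϱ α (gen₁ L) (gen₂ L) w' kingN kingZ
        (fun x => ¬ IdealNear wd hi x ∧ ‖bondVec (gen₁ L) (gen₂ L) w' x‖ ≤ D) (ΘR₂ L w') (ΘN₂ L w')) :
    BoxSchemeP s Λ c₀ ℓ₀ ϱ α B
      (fun L w' => pathSpliceN D (gen₁ L) (gen₂ L) w' (idealSpliceN wd hi (np₁ L w') kingN) kingN)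
      (fun L w' => pathSpliceZ D (gen₁ L) (gen₂ L) w' (idealSpliceZ wd hi (z₁ L w') kingZ) kingZ)
      (fun L w' y => ΘR₁ L w' y + ΘR₂ L w' y + (1 + α) * θ) (fun L w' y => ΘN₁ L w' y + ΘN₂ L w' y + (1 + α⁻¹) * θ) := by
  refine boxSchemeP_of_splitBox hα hcB hϱ0 hD hnD h2 hnD₁ hθ hgen hwB fun a ha L w' hA hB => ?_
  obtain ⟨hP₁, hS₁⟩ := hnear a ha L w' hA hB
  have hw : IsLayeredCrystal cB (gen₁ L) (gen₂ L) w' := hwB a ha L w' hA hB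
  have hlip : ∀ m : ℤ, ‖w' (m + 1) - w' m‖ ≤ ℓ₀ := hA.2.2.2.2.1
  have hK := isPathSystemOn_of (isPathSystem_king hcB hw hlip (hgen L w' hB))
    (fun x => ¬ IdealNear wd hi x ∧ ‖bondVec (gen₁ L) (gen₂ L) w' x‖ ≤ D)
  exact ⟨isPathSystemOn_idealCover hP₁ hK, schemeDominatedOnP_idealCover hS₁ (hmid a ha L w' hA hB)⟩

end Summit.AtomisticToContinuum.Crystallization.Theorems.ChartedZeroExcessLayeredLatticeLiouville
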